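import Mathlib
import Summits.NavierStokesRegularity.NavierStokesRegularity.Theorems.ThreadingFluxAzimuthalCartanConicalLandau
import Summits.NavierStokesRegularity.NavierStokesRegularity.Theorems.ThreadingFluxAzimuthalCartanConicalShellLandau
import HarnessLib

/-!
# Crux `PoloidalLiouville` (stmt-NavierStokesRegularity-1222, wall W1), crux idea «azimuthal-cartan-test» (ns-idea-15 g10):
# ŠVERÁK'S BERNOULLI HEAD VANISHES ON THE IMAGE OF THE CONFORMAL CORRESPONDENCE — two obstructions to being a conical Liouville flow

Support file (`--supports stmt-NavierStokesRegularity-1222`, helper; cell `ns-wall-extremal`, width hand ns-wall-eng-6 g7, 0 kit).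
A SCOPE RESULT for the conical method (director-ns g19 p115): what separates the image of the conformal correspondence from the rest
of the unthreaded `(−1)`-homogeneous steady stratum on a cone.

Šverák's classification of the `(−1)`-homogeneous steady Navier–Stokes flows smooth on `ℝ³ ∖ {0}` (arXiv:math/0604550 §4; tree:
`Literature.Analysis.FluidPDE.Sverak2011.bernoulliK_const_and_radVort_eq_zero`, `….exists_conformal_potential`) runs through the
`0`-homogeneous BERNOULLI HEAD `K = |x|²(½|u|² + p) − ½F² − F`, `F = ⟪x, u⟫` (`= ½|v|² + p − f` on the unit sphere): on the whole
sphere `ΔK − u·∇K = ⟪x, curl u⟫² ≥ 0` and the maximum principle force `K ≡ const`, then two further integrations over `S²` force the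
constant (`k₀`) to be `0` and the conformal weight `w = 2 + F` to be `2e^{φ}`, i.e. the flow to come from LIOUVILLE DATA
(`LiouvilleCone`, `ThreadingFluxAzimuthalCartanConicalCorrespondence.lean`) — globally: to be Landau.

ON A CONE none of the three sphere integrations is available, and the image of the constructive correspondence
`LiouvilleCone.correspondence` (ns-wall-eng-6 g5, C2) is a PROPER part of the unthreaded `(−1)`-homogeneous steady stratum.  This
file isolates the two cheapest invariants separating them, in the card's objects:

* `conicalHead V p x = ‖x‖²(½‖V x‖² + p x) − ½⟪x, V x⟫² − ⟪x, V x⟫` — Šverák's `K` (the Literature series' `K` with `P₂ = p`, which is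
  what `P₂ = −½ x·∇p` is for a `(−2)`-homogeneous pressure);
* ★ `LiouvilleCone.conicalHead_eq_zero` — on every conical Liouville flow (`conicalField Φ`, `conicalPressure Φ`) the head VANISHES
  IDENTICALLY (`F = 2e^{Φ} − 2 = h|x|²`, `|u|² = |∇Φ|² + h²|x|²`, `p = h − ½|∇Φ|²` ⇒ `K = ½F² + F − ½F² − F = 0`);
* `exists_pressure_eq_add` — two pressures of one velocity field on an open connected set differ by a constant;
* ★★ `LiouvilleCone.exists_ne_conicalField_of_conicalHead` — HEAD OBSTRUCTION: a classical steady flow `(V, p)` on the cone `U` of some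
  Liouville data whose head is a NON-ZERO constant `k` on `U` differs from the conical field somewhere on `U` (on a ball where they
  agreed, `p = conicalPressure Φ + a`, so `k = a|x|²` at two points of different norms on one ray: `a = 0 = k`);
* ★ `LiouvilleCone.ne_conicalField_of_inner_le` — SIGN OBSTRUCTION: conical fields have `⟪x, u⟫ = 2e^{Φ} − 2 > −2`
  (`inner_self_conicalField`, Λ2), so a field with `⟪x, V x⟫ ≤ −2` at a point of `U` is not the conical field there.

The sequels `ThreadingFluxAzimuthalCartanConicalSlezkinField.lean` / `…ConicalSlezkinWitness.lean` feed both with the explicit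
rational Slezkin cone flows `u_β = ((2−β)x₀/ρ² − 2x₀/x₂², (2−β)x₁/ρ² − 2x₁/x₂², −4/x₂)` (steady NS on `{x₂ ≠ 0, ρ ≠ 0}`, unthreaded,
`(−1)`-homogeneous, head `≡ β − β²/2`, `⟪x, u_β⟫ = −2 − β − 2ρ²/x₂²`): for every `β` they lie outside the image on every cone.

READING (information-grade; W1 movement 0).  Locally on a cone the unthreaded `(−1)`-homogeneous steady stratum is Šverák's system
`{Δ_{S²}φ = 2 − w, −Δ_{S²}w + div_{S²}(w∇φ) = 2k₀}` (the tree's (E2) plus `div u = 0`; `k₀` = the head), of which the Liouville class is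
the sub-locus `{k₀ = 0, w = 2e^{φ}}`; the head is the first coordinate transverse to it.

HONEST FRAME: explicit steady local vector calculus strictly below W1; closes no Prop of the sketch (I♭, C♯ stay conjectures);
`PoloidalLiouville` (1222) and NS regularity are OPEN / NOT proved.

## References
* V. Šverák, On Landau's solutions of the Navier–Stokes equations, J. Math. Sci. 179 (2011) 208–228, arXiv:math/0604550, §4 (Lemma 1,
  (E2)–(E4)). [Sverak2011]
* N. A. Slezkin, On an exact solution of the equations of viscous flow, Uch. zap. MGU 2 (1934) 89–90; L. D. Landau, Dokl. Akad. Nauk SSSR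
  43 (1944) 286–288; H. B. Squire, Quart. J. Mech. Appl. Math. 4 (1951) 321–329 (the axisymmetric conical family). [folklore]
* L. Li, Y. Y. Li, X. Yan, Homogeneous solutions of stationary Navier–Stokes equations with isolated singularities on the unit sphere,
  I–II, arXiv:1609.08197, arXiv:1704.08730 (the local conical families beyond Landau).
-/

-- the summit and its single sub-problem share the name (CONVENTIONS §1)
set_option linter.dupNamespace false

noncomputable section

namespace Summit.NavierStokesRegularity.NavierStokesRegularity.Theorems.PoloidalLiouville.AzimuthalCartan

open Set Function Filter Topology Metric
open scoped RealInnerProductSpace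
open Literature.Analysis.FluidPDE
open Summit.NavierStokesRegularity.NavierStokesRegularity.Theorems.PoloidalLiouville.CentreJet (E3 IsSteadyNSOn)

/-! ### The head -/

/-- ŠVERÁK'S BERNOULLI HEAD of a velocity–pressure pair at `x`: `K = |x|²(½|V|² + p) − ½⟪x, V⟫² − ⟪x, V⟫` — homogeneous of degree `0`
when `V` is `(−1)`- and `p` is `(−2)`-homogeneous; `= ½|v|² + p − f` on the unit sphere in Šverák's notation `u = v + fσ`.
[Šverák 2011 §4; tree `Literature.Analysis.FluidPDE.Sverak2011.bernoulliK_const_and_radVort_eq_zero` (its `K` with `P₂ = p`)] -/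
def conicalHead (V : E3 → E3) (p : E3 → ℝ) (x : E3) : ℝ :=
  ‖x‖ ^ 2 * (‖V x‖ ^ 2 / 2 + p x) - ⟪x, V x⟫ ^ 2 / 2 - ⟪x, V x⟫

/-- The head only sees the values `V x`, `p x`. -/
theorem conicalHead_congr {V V' : E3 → E3} {p p' : E3 → ℝ} {x : E3} (hV : V x = V' x) (hp : p x = p' x) :
    conicalHead V p x = conicalHead V' p' x := by
  simp only [conicalHead, hV, hp]

/-- Shifting the pressure by a constant `a` shifts the head by `a|x|²`. -/
theorem conicalHead_pressure_add_const (V : E3 → E3) (p : E3 → ℝ) (a : ℝ) (x : E3) :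
    conicalHead V (fun y => p y + a) x = conicalHead V p x + a * ‖x‖ ^ 2 := by
  simp only [conicalHead]
  ring

/-! ### Two pressures of one flow differ by a constant -/

/-- The momentum equation determines `∇p` from `V`: two pressures of one velocity field have the same gradient. -/
theorem gradient_pressure_eq {U : Set E3} {V : E3 → E3} {p q : E3 → ℝ} (hp : IsSteadyNSOn U V p) (hq : IsSteadyNSOn U V q)
    {x : E3} (hx : x ∈ U) : gradient p x = gradient q x := by
  have h₁ := hp.2.2.2 x hx
  have h₂ := hq.2.2.2 x hx
  exact add_left_cancel (h₁.trans h₂.symm)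

/-- ★ **Two pressures of one velocity field on an open preconnected set differ by a constant.** -/
theorem exists_pressure_eq_add {U : Set E3} {V : E3 → E3} {p q : E3 → ℝ} (hU : IsOpen U) (hU' : IsPreconnected U)
    (hp : IsSteadyNSOn U V p) (hq : IsSteadyNSOn U V q) : ∃ a : ℝ, ∀ x ∈ U, q x = p x + a := by
  have hdp : DifferentiableOn ℝ p U := hp.2.1.differentiableOn one_ne_zero
  have hdq : DifferentiableOn ℝ q U := hq.2.1.differentiableOn one_ne_zero
  have hfd : U.EqOn (fderiv ℝ q) (fderiv ℝ p) := fun x hx => by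
    have h := gradient_pressure_eq hp hq hx
    have h' := congrArg (InnerProductSpace.toDual ℝ E3) h
    simpa [gradient] using h'.symm
  obtain ⟨a, ha⟩ := hU.exists_eq_add_of_fderiv_eq hU' hdq hdp hfd
  exact ⟨a, fun x hx => ha hx⟩

namespace LiouvilleCone

variable {U : Set E3} {Φ : E3 → ℝ} {g : E3 → E3} {H : E3 → E3 →L[ℝ] E3} (hc : LiouvilleCone U Φ g H) {x : E3}
include hc

/-! ### The head vanishes on the image of the correspondence -/

/-- `|u|² = |∇Φ|² + h²|x|²` for the conical field (Euler `⟪x, ∇Φ⟫ = 0` kills the cross term). -/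
theorem norm_sq_conicalField (hx : x ∈ U) :
    ‖conicalField Φ x‖ ^ 2 = ‖g x‖ ^ 2 + radialCoeff Φ x ^ 2 * ‖x‖ ^ 2 := by
  have he : ⟪x, g x⟫ = 0 := hc.euler x hx
  have he' : ⟪g x, x⟫ = 0 := by rw [real_inner_comm]; exact he
  rw [hc.conicalField_eq hx, ← real_inner_self_eq_norm_sq, inner_add_left, inner_add_right, inner_add_right, inner_smul_left,
    inner_smul_right, inner_smul_left, inner_smul_right, real_inner_self_eq_norm_sq, real_inner_self_eq_norm_sq, he, he']
  simp
  ring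

/-- ★ **The Bernoulli head vanishes identically on every conical Liouville flow.**  [Šverák 2011 §4: `K ≡ k₀`, `k₀ = 0` on `S²`; here
the pointwise identity on the image of the correspondence, on any cone] -/
theorem conicalHead_eq_zero (hx : x ∈ U) : conicalHead (conicalField Φ) (conicalPressure Φ) x = 0 := by
  have hr : ‖x‖ ≠ 0 := hc.norm_ne_zero hx
  have hF : ⟪x, conicalField Φ x⟫ = 2 * Real.exp (Φ x) - 2 := hc.inner_self_conicalField hx
  have hn := hc.norm_sq_conicalField hx
  unfold conicalHead conicalPressure
  rw [hn, hF, hc.gradient_eq hx]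
  unfold radialCoeff
  field_simp
  ring

/-! ### The two obstructions -/

/-- ★ **SIGN OBSTRUCTION.**  Conical fields have `⟪x, u(x)⟫ = 2e^{Φ(x)} − 2 > −2`; a field with `⟪x, V x⟫ ≤ −2` at a point of the cone
is not the conical field there. -/
theorem ne_conicalField_of_inner_le (hx : x ∈ U) {V : E3 → E3} (hV : ⟪x, V x⟫ ≤ -2) : V x ≠ conicalField Φ x := by
  intro h
  have hF := hc.inner_self_conicalField hx
  rw [← h] at hF
  have := Real.exp_pos (Φ x)
  linarith

/-- ★★ **HEAD OBSTRUCTION.**  A classical steady Navier–Stokes flow `(V, p)` on the cone `U ≠ ∅` of the Liouville data whose Bernoulli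
head is a NON-ZERO constant `k` on `U` is not the conical field of the data: `V x ≠ conicalField Φ x` for some `x ∈ U`.  (Were they
equal on `U`, then on a ball `B ⊆ U` about `x₁` both `p` and `conicalPressure Φ` are pressures of one field, so `p = conicalPressure Φ + a`
on `B` and `k = 0 + a|y|²` for `y ∈ B`; at `y = x₁` and `y = (1 + t)x₁` this forces `a = 0`, i.e. `k = 0`.) -/
theorem exists_ne_conicalField_of_conicalHead (hU : U.Nonempty) {V : E3 → E3} {p : E3 → ℝ} (hV : IsSteadyNSOn U V p) {k : ℝ}
    (hk : k ≠ 0) (hK : ∀ x ∈ U, conicalHead V p x = k) : ∃ x ∈ U, V x ≠ conicalField Φ x := by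
  by_contra h
  push Not at h
  obtain ⟨x₁, hx₁⟩ := hU
  obtain ⟨r, hr, hball⟩ := Metric.isOpen_iff.mp hc.isOpen x₁ hx₁
  have hB : IsOpen (ball x₁ r) := isOpen_ball
  -- on the ball both `p` and `conicalPressure Φ` are pressures of the conical field
  have hNS₁ : IsSteadyNSOn (ball x₁ r) (conicalField Φ) (conicalPressure Φ) := ConicalWitness.isSteadyNSOn_mono hc.isSteadyNSOn hball
  have hNS₂ : IsSteadyNSOn (ball x₁ r) (conicalField Φ) p :=
    isSteadyNSOn_congr hB (fun y hy => h y (hball hy)) (fun _ _ => rfl) (ConicalWitness.isSteadyNSOn_mono hV hball)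
  obtain ⟨a, ha⟩ := exists_pressure_eq_add hB (convex_ball x₁ r).isPreconnected hNS₁ hNS₂
  -- hence `k = a |y|²` on the ball
  have hk' : ∀ y ∈ ball x₁ r, k = a * ‖y‖ ^ 2 := fun y hy => by
    rw [← hK y (hball hy), conicalHead_congr (p' := fun z => conicalPressure Φ z + a) (h y (hball hy)) (ha y hy),
      conicalHead_pressure_add_const (conicalField Φ) (conicalPressure Φ) a y, hc.conicalHead_eq_zero (hball hy), zero_add]
  -- two points of the ball on one ray
  have hx0 : ‖x₁‖ ≠ 0 := hc.norm_ne_zero hx₁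
  have hxpos : 0 < ‖x₁‖ := (norm_nonneg _).lt_of_ne' hx0
  set t : ℝ := r / (2 * ‖x₁‖) with ht_def
  have ht : 0 < t := by positivity
  have htn : t * ‖x₁‖ = r / 2 := by
    rw [ht_def]
    field_simp
  have hy : (1 + t) • x₁ ∈ ball x₁ r := by
    rw [mem_ball, dist_eq_norm, add_smul, one_smul, add_sub_cancel_left, norm_smul, Real.norm_of_nonneg ht.le, htn]
    linarith
  have e₁ := hk' x₁ (mem_ball_self hr)
  have e₂ := hk' _ hy
  rw [norm_smul, Real.norm_of_nonneg (by linarith : (0 : ℝ) ≤ 1 + t), mul_pow] at e₂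
  -- `a |x₁|² = a (1+t)² |x₁|²` with `t > 0` forces `a = 0`, hence `k = 0`
  have hsq : 0 < ‖x₁‖ ^ 2 := by positivity
  have ha0 : a = 0 := by
    have h3 : a * ((1 + t) ^ 2 - 1) * ‖x₁‖ ^ 2 = 0 := by nlinarith
    have h4 : (1 + t) ^ 2 - 1 ≠ 0 := by nlinarith
    have h5 : a * ((1 + t) ^ 2 - 1) = 0 := by
      rcases mul_eq_zero.mp h3 with h | h
      · exact h
      · exact absurd h hsq.ne'
    rcases mul_eq_zero.mp h5 with h | h
    · exact h
    · exact absurd h h4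
  rw [ha0, zero_mul] at e₁
  exact hk e₁

end LiouvilleCone

end Summit.NavierStokesRegularity.NavierStokesRegularity.Theorems.PoloidalLiouville.AzimuthalCartan

end
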